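import Summits.QuantumFields.GaugeBoot.BootstrapCertificateTransport
import Summits.QuantumFields.GaugeBoot.BootstrapExactCertificates
import HarnessLib

/-!
# The level-`n` bootstrap at `β = 0` determines EXACTLY the words of length `≤ n` and has slack on every other objective (gauge-boot, L1/L4 supplement)

HONEST FRAMING (cell `pub-gaugeboot`, page 1 of every file): the venture produces certified bounds
on lattice expectations at stated coupling, gauge group, dimension and torus size; NOT a mass gap,
NOT a continuum limit, NOT a string tension; NOT Yang–Mills-summit-bearing (barriers
`FixedCouplingUltralocality`, `PerturbativeInvisibility`). Structural; it certifies no number.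

## Content

`StrongCouplingOrderSuN.levelValues_zero_eq_singleton_suN`: at `β = 0` the level-`n` `SU(N)`
bootstrap pins every test function of word length `≤ n` to its Haar value. Here the converse:

* ★ `exists_abs_apply_mul_self_le` — for a finite-dimensional space `W` of observables and a
  functional `φ₀` faithful on the squares of `W`, every linear `θ` is dominated on squares:
  `|θ (v v)| ≤ C φ₀ (v v)` (compactness of the unit sphere of `W`);
* ★ `isBootstrapFeasible_add_smul_zero` (any lattice) — at `β = 0`, for a test space `V ∋ 1`
  stable under the shift derivations, `φ₀ + η θ` is level-`V` feasible whenever `φ₀` is, `θ` kills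
  `V`, and `|η| C ≤ 1`: the positive-DEFINITE Haar moment matrix absorbs a small perturbation of
  the free (longer-word) entries, and the `β = 0` rows only see `V`;
* ★★★ `exists_mem_levelValues_zero_lt_gt_suN`, `levelValues_zero_eq_singleton_iff_suN` — `SU(N)`
  on the torus `(ℤ/L)^d`, `β = 0`, level `n`, ANY continuous objective `P`: the set of level-`n`
  feasible values of `P` is the single Haar value IF AND ONLY IF `P` is a combination of words of
  length `≤ n`; otherwise it contains values strictly below and strictly above `∫ P dHaar` — the
  `β = 0` SDP is exact on `V_n` and has genuine slack everywhere else.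

Sequel `BootstrapCouplingJump.lean`: objectives pinned at `β ≠ 0` and the jump of the SDP value at
`β = 0`.

References: G. Blekherman, P. Parrilo, R. Thomas (eds.), Semidefinite Optimization and Convex
Algebraic Geometry (SIAM 2012) §3 (moment matrices; interior of the moment cone); P. Anderson,
M. Kruczenski, Nucl. Phys. B 921 (2017); V. Kazakov, Z. Zheng, arXiv:2203.11360. Folklore.
-/

noncomputable section

open MeasureTheory Filter Topology NormedSpace
open Literature.MathematicalPhysics.QuantumFieldTheory (LatticeRep Edge GaugeConfig wilsonAction
  wilsonMeasure isProbabilityMeasure_wilsonMeasure)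
open Literature.MathematicalPhysics.QuantumLattice

namespace Summit.QuantumFields.GaugeBoot

/-! ## Domination of a functional on the squares of a finite-dimensional space -/

section Dominate

variable {ι : Type*} {G : Type*} [TopologicalSpace G] [CompactSpace G]

/-- ★ **Domination on squares.** `W` a finite-dimensional space of observables, `φ₀` a linear
functional with `φ₀ (v v) > 0` for every non-zero `v ∈ W`: every linear `θ` satisfies
`|θ (v v)| ≤ C φ₀ (v v)` on `W` for some `C ≥ 0` (both quadratic functions are continuous on `W`,
the unit sphere of `W` is compact, homogeneity). [folklore] -/
theorem exists_abs_apply_mul_self_le (W : Submodule ℝ C(ι → G, ℝ)) [FiniteDimensional ℝ W]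
    (φ₀ θ : C(ι → G, ℝ) →ₗ[ℝ] ℝ) (hpos : ∀ v ∈ W, v ≠ 0 → 0 < φ₀ (v * v)) :
    ∃ C : ℝ, 0 ≤ C ∧ ∀ v ∈ W, |θ (v * v)| ≤ C * φ₀ (v * v) := by
  classical
  -- the squares live in the finite-dimensional submodule `W * W`
  haveI hWW : FiniteDimensional ℝ ↥(W * W) :=
    Module.Finite.iff_fg.mpr ((Module.Finite.iff_fg.mp ‹FiniteDimensional ℝ W›).mul
      (Module.Finite.iff_fg.mp ‹FiniteDimensional ℝ W›))
  let sq : W → ↥(W * W) := fun v => ⟨(v : C(ι → G, ℝ)) * v, Submodule.mul_mem_mul v.2 v.2⟩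
  have hsq : Continuous sq :=
    (continuous_subtype_val.mul continuous_subtype_val).subtype_mk _
  have hcθ : Continuous fun v : W => θ ((v : C(ι → G, ℝ)) * v) := by
    have h : (fun v : W => θ ((v : C(ι → G, ℝ)) * v)) = (θ ∘ₗ (W * W).subtype) ∘ sq := rfl
    rw [h]
    exact (LinearMap.continuous_of_finiteDimensional _).comp hsq
  have hcφ : Continuous fun v : W => φ₀ ((v : C(ι → G, ℝ)) * v) := by
    have h : (fun v : W => φ₀ ((v : C(ι → G, ℝ)) * v)) = (φ₀ ∘ₗ (W * W).subtype) ∘ sq := rfl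
    rw [h]
    exact (LinearMap.continuous_of_finiteDimensional _).comp hsq
  -- homogeneity (in the ambient space)
  have hhom : ∀ (ψ : C(ι → G, ℝ) →ₗ[ℝ] ℝ) (t : ℝ) (x : C(ι → G, ℝ)),
      ψ ((t • x) * (t • x)) = t * t * ψ (x * x) := by
    intro ψ t x
    rw [smul_mul_smul, map_smul, smul_eq_mul]
  have hnormW : ∀ x : W, ‖x‖ = ‖(x : C(ι → G, ℝ))‖ := fun x => rfl
  -- normalising a non-zero `v ∈ W` onto the unit sphere of `W`
  have hunit : ∀ v ∈ W, v ≠ 0 →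
      ∃ u : W, u ∈ Metric.sphere (0 : W) 1 ∧ v = ‖v‖ • (u : C(ι → G, ℝ)) := by
    intro v hv hv0
    have hn : 0 < ‖v‖ := norm_pos_iff.2 hv0
    refine ⟨‖v‖⁻¹ • ⟨v, hv⟩, ?_, ?_⟩
    · rw [mem_sphere_zero_iff_norm]
      change ‖(‖v‖⁻¹ • v : C(ι → G, ℝ))‖ = 1
      rw [norm_smul, Real.norm_of_nonneg (inv_nonneg.2 hn.le), inv_mul_cancel₀ hn.ne']
    · rw [Submodule.coe_smul, smul_smul, mul_inv_cancel₀ hn.ne', one_smul]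
  set S := Metric.sphere (0 : W) 1 with hS
  have hSc : IsCompact S := isCompact_sphere _ _
  by_cases hne : S.Nonempty
  · obtain ⟨v₀, hv₀S, hmin⟩ := hSc.exists_isMinOn hne hcφ.continuousOn
    obtain ⟨v₁, hv₁S, hmax⟩ := hSc.exists_isMaxOn hne (continuous_abs.comp hcθ).continuousOn
    have hv₀ne : (v₀ : C(ι → G, ℝ)) ≠ 0 := by
      intro h
      have h1 : ‖v₀‖ = 1 := mem_sphere_zero_iff_norm.1 hv₀S
      rw [hnormW, h, norm_zero] at h1
      exact zero_ne_one h1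
    set δ := φ₀ ((v₀ : C(ι → G, ℝ)) * v₀) with hδ
    set M := |θ ((v₁ : C(ι → G, ℝ)) * v₁)| with hM
    have hδ0 : 0 < δ := hpos _ v₀.2 hv₀ne
    have hM0 : 0 ≤ M := abs_nonneg _
    refine ⟨M / δ, div_nonneg hM0 hδ0.le, fun v hv => ?_⟩
    by_cases hv0 : v = 0
    · rw [hv0, mul_zero, map_zero, map_zero, abs_zero, mul_zero]
    obtain ⟨u, huS, hvu⟩ := hunit v hv hv0
    have hθv : θ (v * v) = ‖v‖ * ‖v‖ * θ ((u : C(ι → G, ℝ)) * u) := by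
      conv_lhs => rw [hvu]
      exact hhom θ ‖v‖ u
    have hφv : φ₀ (v * v) = ‖v‖ * ‖v‖ * φ₀ ((u : C(ι → G, ℝ)) * u) := by
      conv_lhs => rw [hvu]
      exact hhom φ₀ ‖v‖ u
    have h1 : |θ ((u : C(ι → G, ℝ)) * u)| ≤ M := hmax huS
    have h2 : δ ≤ φ₀ ((u : C(ι → G, ℝ)) * u) := hmin huS
    have hnn : 0 ≤ ‖v‖ * ‖v‖ := mul_nonneg (norm_nonneg _) (norm_nonneg _)
    rw [hθv, hφv, abs_mul, abs_of_nonneg hnn]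
    calc ‖v‖ * ‖v‖ * |θ ((u : C(ι → G, ℝ)) * u)| ≤ ‖v‖ * ‖v‖ * M :=
          mul_le_mul_of_nonneg_left h1 hnn
      _ = M / δ * (‖v‖ * ‖v‖ * δ) := by field_simp
      _ ≤ M / δ * (‖v‖ * ‖v‖ * φ₀ ((u : C(ι → G, ℝ)) * u)) :=
          mul_le_mul_of_nonneg_left (mul_le_mul_of_nonneg_left h2 hnn) (div_nonneg hM0 hδ0.le)
  · refine ⟨0, le_rfl, fun v hv => ?_⟩
    have hv0 : v = 0 := by
      by_contra h
      obtain ⟨u, huS, -⟩ := hunit v hv h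
      exact hne ⟨u, huS⟩
    rw [hv0, mul_zero, map_zero, map_zero, abs_zero, mul_zero]

end Dominate

/-! ## General lattice: perturbing a `β = 0` solution -/

section General

variable {ι : Type*} [DecidableEq ι] [Countable ι] {G : Type*} [Group G] [TopologicalSpace G]
  [IsTopologicalGroup G] [CompactSpace G] [MeasurableSpace G] [BorelSpace G]
  [SecondCountableTopology G] (r : LatticeRep G) {K : Type*}
  {k : K → ℝ → G} {X : K → Matrix (Fin r.N) (Fin r.N) ℂ} {S : ι → (ι → G) → ℝ} {β : ℝ}

omit [Countable ι] [IsTopologicalGroup G] [CompactSpace G] [MeasurableSpace G] [BorelSpace G]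
  [SecondCountableTopology G] in
/-- ★ **Perturbation of a `β = 0` solution.** Test space `V` (a subspace containing `1`, stable
under the shift derivations `sderiv k i a`); `φ₀` level-`V` feasible at `β = 0`; `θ` a linear
functional vanishing on `V` with `|θ (v v)| ≤ C φ₀ (v v)` on `V`; `|η| C ≤ 1`. Then `φ₀ + η • θ`
is level-`V` feasible at `β = 0` (normalisation and the `β = 0` rows only see `V`, which `θ` kills;
positivity survives by domination). [folklore] -/
theorem isBootstrapFeasible_add_smul_zero {V : Submodule ℝ C(ι → G, ℝ)} (h1 : (1 : C(ι → G, ℝ)) ∈ V)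
    (hVd : ∀ (i : ι) (a : K), ∀ f ∈ V, sderiv k i a f ∈ V)
    {φ₀ : C(ι → G, ℝ) →ₗ[ℝ] ℝ} (hφ₀ : IsBootstrapFeasible r k S 0 (V : Set C(ι → G, ℝ)) φ₀)
    {θ : C(ι → G, ℝ) →ₗ[ℝ] ℝ} (hθV : ∀ v ∈ V, θ v = 0) {C : ℝ}
    (hC : ∀ v ∈ V, |θ (v * v)| ≤ C * φ₀ (v * v)) {η : ℝ} (hη : |η| * C ≤ 1) :
    IsBootstrapFeasible r k S 0 (V : Set C(ι → G, ℝ)) (φ₀ + η • θ) := by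
  refine ⟨?_, fun v hv => ?_, fun i a => ?_⟩
  · rw [LinearMap.add_apply, LinearMap.smul_apply, hφ₀.1, hθV 1 h1, smul_zero, add_zero]
  · rw [LinearMap.add_apply, LinearMap.smul_apply, smul_eq_mul]
    have hp : 0 ≤ φ₀ (v * v) := hφ₀.2.1 v hv
    have h2 : |η * θ (v * v)| ≤ φ₀ (v * v) := by
      rw [abs_mul]
      calc |η| * |θ (v * v)| ≤ |η| * (C * φ₀ (v * v)) :=
            mul_le_mul_of_nonneg_left (hC v hv) (abs_nonneg η)
        _ = |η| * C * φ₀ (v * v) := by ring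
        _ ≤ 1 * φ₀ (v * v) := mul_le_mul_of_nonneg_right hη hp
        _ = φ₀ (v * v) := one_mul _
    linarith [(abs_le.1 h2).1]
  · obtain ⟨S', hS'm, hS'd, hrows⟩ := hφ₀.2.2 i a
    refine ⟨S', hS'm, hS'd, fun f hf f' hf'm hf'd => ?_⟩
    have h0 : φ₀ f' = 0 := by rw [hrows f hf f' hf'm hf'd, zero_mul]
    have he : sderiv k i a f = f' := HasShiftDeriv.sderiv_eq hf'd
    have hθ : θ f' = 0 := by rw [← he]; exact hθV _ (hVd i a f hf)
    rw [zero_mul, LinearMap.add_apply, LinearMap.smul_apply, h0, hθ, smul_zero, add_zero]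

end General

/-! ## `SU(N)` on the torus: exact on `V_n`, slack beyond -/

section SuN

variable {d L : ℕ} [NeZero L] (N : ℕ)

/-- ★★★ **At `β = 0` the level-`n` bootstrap has slack on every objective outside `V_n`.**
`SU(N)`, torus `(ℤ/L)^d`, any level `n`, any continuous objective `P` which is NOT a combination of
words of length `≤ n`: the level-`n` feasible values of `P` at `β = 0` contain a value strictly
below and a value strictly above the Haar expectation `∫ P dμ₀`. [folklore] -/
theorem exists_mem_levelValues_zero_lt_gt_suN {n : ℕ}
    {P : C(GaugeConfig d L (Matrix.specialUnitaryGroup (Fin N) ℂ), ℝ)}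
    (hP : P ∉ wordTruncation (ι := Edge d L) (fundamentalLatticeRep N) n) :
    (∃ t ∈ levelValuesSuN (d := d) (L := L) N 0 n P,
        t < ∫ U, P U ∂(wilsonMeasure (fundamentalRep (Fin N)) 0)) ∧
      ∃ t ∈ levelValuesSuN (d := d) (L := L) N 0 n P,
        ∫ U, P U ∂(wilsonMeasure (fundamentalRep (Fin N)) 0) < t := by
  classical
  haveI : IsProbabilityMeasure (wilsonMeasure (d := d) (L := L) (fundamentalRep (Fin N)) 0) :=
    isProbabilityMeasure_wilsonMeasure (ρ := fundamentalRep (Fin N)) (continuous_fundamentalRep _) 0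
  set W : Submodule ℝ C(GaugeConfig d L (Matrix.specialUnitaryGroup (Fin N) ℂ), ℝ) :=
    Submodule.span ℝ (wordsUpTo (ι := Edge d L) (fundamentalLatticeRep N) n) with hW
  haveI : FiniteDimensional ℝ W :=
    FiniteDimensional.span_of_finite ℝ (wordsUpTo_finite (fundamentalLatticeRep N) n)
  have hWV : (W : Set _) = wordTruncation (ι := Edge d L) (fundamentalLatticeRep N) n := rfl
  have hPW : P ∉ W := hP
  -- a functional killing `W` and not `P`
  obtain ⟨θ, hθP, hθW⟩ := W.exists_dual_map_eq_bot_of_notMem hPW inferInstance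
  have hθV : ∀ v ∈ W, θ v = 0 := fun v hv =>
    (Submodule.eq_bot_iff _).1 hθW _ (Submodule.mem_map_of_mem hv)
  -- the Haar functional: feasible at `β = 0`, faithful
  set φ₀ := expectationFunctional (wilsonMeasure (d := d) (L := L) (fundamentalRep (Fin N)) 0) with hφ₀
  have hfeas : IsBootstrapFeasible (fundamentalLatticeRep N) (suExp N)
      (fun _ => wilsonAction (fundamentalRep (Fin N))) 0 (W : Set _) φ₀ := by
    rw [hWV]
    exact isBootstrapFeasible_wilson_suN N 0 _ rfl (wordTruncation_subset_polyAlgebra _ n)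
  have hpos : ∀ v ∈ W, v ≠ 0 → 0 < φ₀ (v * v) := by
    intro v _ hv
    refine lt_of_le_of_ne (expectationFunctional_sq_nonneg _ v) fun h => hv ?_
    exact eq_zero_of_integral_mul_self_eq_zero (fundamentalRep (Fin N)) v
      (by rw [← expectationFunctional_apply]; exact h.symm)
  obtain ⟨C, hC0, hC⟩ := exists_abs_apply_mul_self_le W φ₀ θ hpos
  -- the perturbed functionals `φ₀ ± η θ`
  have h1 : (1 : C(GaugeConfig d L (Matrix.specialUnitaryGroup (Fin N) ℂ), ℝ)) ∈ W :=
    one_mem_wordTruncation (fundamentalLatticeRep N) n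
  have hVd : ∀ (i : Edge d L) (a : SuGenerator N), ∀ f ∈ W, sderiv (suExp N) i a f ∈ W := by
    intro i a f hf
    exact mem_wordTruncation_of_mem_wordSpace _ (sderiv_mem_wordSpace (suExp_add N)
      (X := fun X : SuGenerator N => (X : Matrix (Fin N) (Fin N) ℂ)) (rho_suExp N) i a
      (mem_wordSpace_univ_of_mem_wordTruncation _ hf))
  set η : ℝ := 1 / (C + 1) with hη
  have hη0 : 0 < η := by rw [hη]; exact div_pos one_pos (by linarith)
  have hηC : |η| * C ≤ 1 := by
    rw [abs_of_pos hη0, hη, div_mul_eq_mul_div, one_mul, div_le_one (by linarith)]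
    linarith
  have hηC' : |(-η)| * C ≤ 1 := by rwa [abs_neg]
  have hplus := isBootstrapFeasible_add_smul_zero (fundamentalLatticeRep N) h1 hVd hfeas hθV hC hηC
  have hminus := isBootstrapFeasible_add_smul_zero (fundamentalLatticeRep N) h1 hVd hfeas hθV hC hηC'
  rw [hWV] at hplus hminus
  have hval : φ₀ P = ∫ U, P U ∂(wilsonMeasure (fundamentalRep (Fin N)) 0) := rfl
  have hvp : (φ₀ + η • θ) P = φ₀ P + η * θ P := rfl
  have hvm : (φ₀ + (-η) • θ) P = φ₀ P - η * θ P := by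
    rw [LinearMap.add_apply, LinearMap.smul_apply, smul_eq_mul, neg_mul, ← sub_eq_add_neg]
  have hηθ : η * θ P ≠ 0 := mul_ne_zero hη0.ne' hθP
  rcases lt_or_gt_of_ne hηθ with hlt | hgt
  · refine ⟨⟨_, ⟨_, hplus, rfl⟩, ?_⟩, ⟨_, ⟨_, hminus, rfl⟩, ?_⟩⟩
    · rw [hvp, ← hval]; linarith
    · rw [hvm, ← hval]; linarith
  · refine ⟨⟨_, ⟨_, hminus, rfl⟩, ?_⟩, ⟨_, ⟨_, hplus, rfl⟩, ?_⟩⟩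
    · rw [hvm, ← hval]; linarith
    · rw [hvp, ← hval]; linarith

/-- ★★★ **At `β = 0` the level-`n` bootstrap determines EXACTLY the observables of word length
`≤ n`.** `SU(N)`, torus, any `n`, any continuous objective `P`: the level-`n` feasible values of
`P` at `β = 0` reduce to the single Haar value if and only if `P ∈ V_n` (the span of the words of
length `≤ n`). [folklore] -/
theorem levelValues_zero_eq_singleton_iff_suN {n : ℕ}
    (P : C(GaugeConfig d L (Matrix.specialUnitaryGroup (Fin N) ℂ), ℝ)) :
    levelValuesSuN (d := d) (L := L) N 0 n P = {∫ U, P U ∂(wilsonMeasure (fundamentalRep (Fin N)) 0)} ↔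
      P ∈ wordTruncation (ι := Edge d L) (fundamentalLatticeRep N) n := by
  refine ⟨fun h => ?_, fun hP => levelValues_zero_eq_singleton_suN N le_rfl hP⟩
  by_contra hP
  obtain ⟨-, t, ht, hlt⟩ := exists_mem_levelValues_zero_lt_gt_suN N hP
  rw [h, Set.mem_singleton_iff] at ht
  rw [ht] at hlt
  exact lt_irrefl _ hlt

end SuN

end Summit.QuantumFields.GaugeBoot

end
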